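import Summits.HodgeConjecture.HodgeConjecture.Theorems.PadicSemiregularLiftHodgeFermatVarietiesStubClaimLevelPush
import HarnessLib

/-!
# `stub_claimLevelPull` from the level map: claim pulls back along `[xᵢ] ↦ [xᵢᵏ]` — line `cancel-by-any-claim-lattice`, crux `HodgeFermatVarieties` (stmt-HodgeConjecture-1334)

Helper file (`--supports stmt-HodgeConjecture-1334`) for the stub `stub_claimLevelPull` (S2↑) of the
skeleton of line `cancel-by-any-claim-lattice`: claim_m(α') ⟹ claim_{km}(k • α') along the level map
`π : X²ʳ_{km} → X²ʳₘ`, `[xᵢ] ↦ [xᵢᵏ]` (Shioda–Katsura, Tôhoku Math. J. 31 (1979) §1; Aoki, J. Math.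
Soc. Japan 39 (1987) p. 387 and Cor. 2-3; da Silva, arXiv:2101.04739 Thm. 2.8), the companion of the
landed S2↓ file `…StubClaimLevelPush`.

PROVED here, on the tree's real carriers (`complexBetti = H*(–(ℂ); ℂ)`, `algebraicClasses = Nᵖ H²ᵖ`,
`fermatEigenspace`, `fermatProjector`), GRANTED for all `m, k ≥ 1` and `r` a morphism
`π : fermatHypersurface (2r) (km) ⟶ fermatHypersurface (2r) m` with
(M2) the points formula — the homogeneous coordinates of `π(x)` are a scalar multiple of `(zᵢᵏ)ᵢ`,
(M3) `Flat π.left`, and (M4) transfer — every class of `H²ʳ(X_{km}(ℂ); ℂ)` fixed by the kernel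
`K = {a ∈ μ_{km}^{2r+2} | aᵏ = 1}` of the `k`-th power map lies in the range of `π^*`:

* `mapContinuous_comp_diagonalMap_of_levelMap` — (M2) ⟹ **`π ∘ g_a = g_{aᵏ} ∘ π`** on complex
  points (homogeneous coordinates through the injective `hypersurfacePoint`), whence on cohomology
  `g_a^* ∘ π^* = π^* ∘ g_{aᵏ}^*` (`map_diagonalMap_map_of_levelMap`) and
  **`π^* V_m(γ) ⊆ V_{km}(k • γ)`** (`map_mem_fermatEigenspace_of_levelMap`; `χ_{k•γ}(a) = χ_γ(aᵏ)`,
  `fermatCharacter_levelRaise`);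
* `stub_claimLevelPull_of_levelMap` — **S2↑ from (M1)–(M4)**, the registered conditional statement:
  for `c ∈ V_{km}(k • α')`, `χ_{k•α'}` is trivial on `K`, so `c = π^* c₀` by (M4); decomposing
  `c₀ = Σ_γ proj_γ c₀` (`sum_fermatProjector`) and applying the projector onto `V_{km}(k • α')`
  (`π^* proj_γ c₀ ∈ V_{km}(k • γ)`, `γ ↦ k • γ` injective) gives `c = π^*(proj_{α'} c₀)` with
  `proj_{α'} c₀ ∈ V_m(α') ⊆ Alg(X_m)` by claim_m(α'), and flat pull-back preserves `Nʳ H²ʳ`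
  (`map_mem_algebraicClasses_of_flat`, (M3)). Degenerate cases: `r = 0` (`FermatCharacter.claim_zero`),
  `m = 0` (`claim_level_zero` of the Push file).

REMAINING CONSTRUCTIONS (not in the tree, 2026-08-17): (M1) the morphism `π` (the graded endomorphism
`xᵢ ↦ xᵢᵏ` scales degrees by `k`, outside Mathlib's `Proj.map`), (M3) its flatness, (M4) the transfer
`H(X_{km})^K = π^* H(X_m)` for the (non-free) quotient `X_m = X_{km}/K`.

## References

* [ShiodaKatsura1979] T. Shioda, T. Katsura, On Fermat varieties, Tôhoku Math. J. 31 (1979), §1.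
* [Aoki1987] N. Aoki, Some new algebraic cycles on Fermat varieties, J. Math. Soc. Japan 39 (1987),
  §1 p. 387 and Cor. 2-3.
* [daSilva2021HodgeFermat] G. da Silva Jr., arXiv:2101.04739, Thm. 2.8.
* [Shioda1979PJA] T. Shioda, Proc. Japan Acad. 55A (1979) 111–114, §4 (the group `μₘⁿ⁺²`, `V(α)`).
* [Hartshorne1977] R. Hartshorne, Algebraic Geometry, III Prop. 9.5 (flat pull-back).
-/

set_option linter.dupNamespace false

noncomputable section

open CategoryTheory AlgebraicGeometry Finset
open Literature.AlgebraicGeometry Literature.AlgebraicGeometry.Motives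
open Literature.AlgebraicGeometry.HodgeTheory Literature.AlgebraicGeometry.HodgeTheory.FermatCharacter
open Literature.AlgebraicTopology.SingularHomology

namespace Summit.HodgeConjecture.HodgeConjecture.Theorems.CancelByAnyClaimLattice

/-! ### The `k`-th power map `μ_{km}ⁿ⁺² → μₘⁿ⁺²` and the characters `χ_{k•γ}` -/

section PowerMap

variable {n m k : ℕ}

/-- `a ∈ μ_{km}ⁿ⁺² ⟹ aᵏ ∈ μₘⁿ⁺²` (`(aᵢᵏ)ᵐ = aᵢ^{km} = 1`). [cite: ShiodaKatsura1979, §1] -/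
theorem pow_mem_fermatGroup_of_mem_mul {a : Fin (n + 2) → ℂˣ} (ha : a ∈ fermatGroup n (k * m)) :
    a ^ k ∈ fermatGroup n m :=
  mem_fermatGroup_iff.mpr fun i ↦ by rw [Pi.pow_apply, ← pow_mul, mem_fermatGroup_iff.mp ha i]

/-- The representative of `k • ⟨v⟩ ∈ ℤ/km` is `k⟨v⟩` for `v ∈ ℤ/m`, `m ≥ 1`. [folklore] -/
theorem val_levelRaise_coord [NeZero m] (hk : 0 < k) (v : ZMod m) :
    (((k * v.val : ℕ) : ZMod (k * m))).val = k * v.val :=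
  ZMod.val_cast_of_lt (Nat.mul_lt_mul_of_pos_left (ZMod.val_lt v) hk)

/-- **`γ ↦ k • γ` is injective** `(ℤ/m)ⁿ⁺² → (ℤ/km)ⁿ⁺²` (`k ≥ 1`, `m ≥ 1`): `k⟨γᵢ⟩ < km` determines
`⟨γᵢ⟩`. [folklore] -/
theorem levelRaise_injective [NeZero m] (hk : 0 < k) {γ γ' : Fin (n + 2) → ZMod m}
    (h : (fun i ↦ ((k * (γ i).val : ℕ) : ZMod (k * m))) = fun i ↦ ((k * (γ' i).val : ℕ) : ZMod (k * m))) :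
    γ = γ' := by
  funext i
  have hi := congrArg ZMod.val (congrFun h i)
  rw [val_levelRaise_coord hk, val_levelRaise_coord hk] at hi
  exact ZMod.val_injective m (Nat.eq_of_mul_eq_mul_left hk hi)

/-- **`χ_{k•γ}(a) = χ_γ(aᵏ)`** for `a ∈ μ_{km}ⁿ⁺²`: `∏ aᵢ^{k⟨γᵢ⟩} = ∏ (aᵢᵏ)^{⟨γᵢ⟩}`.
[cite: Shioda1979PJA, §4] [cite: ShiodaKatsura1979, §1] -/
theorem fermatCharacter_levelRaise [NeZero m] (hk : 0 < k) (γ : Fin (n + 2) → ZMod m)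
    {a : Fin (n + 2) → ℂˣ} (ha : a ∈ fermatGroup n (k * m)) :
    fermatCharacter (k * m) (fun i ↦ ((k * (γ i).val : ℕ) : ZMod (k * m))) ⟨a, ha⟩ =
      fermatCharacter m γ ⟨a ^ k, pow_mem_fermatGroup_of_mem_mul ha⟩ := by
  rw [fermatCharacter_apply, fermatCharacter_apply]
  refine Finset.prod_congr rfl fun i _ ↦ ?_
  change a i ^ (((k * (γ i).val : ℕ) : ZMod (k * m))).val = (a ^ k) i ^ (γ i).val
  rw [val_levelRaise_coord hk, Pi.pow_apply, ← pow_mul]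

/-- **`χ_{k•γ}` is trivial on `K = ker (a ↦ aᵏ)`**: for `a ∈ μ_{km}ⁿ⁺²` with `aᵏ = 1`,
`χ_{k•γ}(a) = χ_γ(1) = 1`. [cite: ShiodaKatsura1979, §1] -/
theorem fermatCharacter_levelRaise_eq_one [NeZero m] (hk : 0 < k) (γ : Fin (n + 2) → ZMod m)
    {a : Fin (n + 2) → ℂˣ} (ha : a ∈ fermatGroup n (k * m)) (hak : a ^ k = 1) :
    fermatCharacter (k * m) (fun i ↦ ((k * (γ i).val : ℕ) : ZMod (k * m))) ⟨a, ha⟩ = 1 := by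
  rw [fermatCharacter_levelRaise hk γ ha]
  have h1 : (⟨a ^ k, pow_mem_fermatGroup_of_mem_mul ha⟩ : fermatGroup n m) = 1 := Subtype.ext hak
  rw [h1, map_one]

end PowerMap

/-! ### Equivariance of the level map: `π ∘ g_a = g_{aᵏ} ∘ π` -/

section Equivariance

variable {n m k : ℕ}

/-- **(M2) ⟹ `π ∘ g_a = g_{aᵏ} ∘ π` on complex points.** If the homogeneous coordinates of `π(x)`
are a scalar multiple of `(zᵢᵏ)ᵢ` for `[z]` those of `x` (the points formula of the level map
`[xᵢ] ↦ [xᵢᵏ]`), then `π` intertwines the diagonal symmetry `a ∈ μ_{km}ⁿ⁺²` of `Xⁿ_{km}` with the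
diagonal symmetry `aᵏ ∈ μₘⁿ⁺²` of `Xⁿₘ`: both composites send `[z]` to `[(aᵢᵏ zᵢᵏ)ᵢ]`, and the
homogeneous-coordinate map `hypersurfacePoint` is injective (`isEmbedding_hypersurfacePoint`).
[cite: ShiodaKatsura1979, §1] [cite: daSilva2021HodgeFermat, Thm. 2.8] -/
theorem mapContinuous_comp_diagonalMap_of_levelMap
    (π : fermatHypersurface n (k * m) ⟶ fermatHypersurface n m)
    (hπ : ∀ x, ∃ t : ℂ, (hypersurfacePoint (SmoothHypersurface.hypersurfaceι (fermatPolynomial ℂ n m))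
        (AlgPoints.map π x)).rep =
      t • fun i => (hypersurfacePoint (SmoothHypersurface.hypersurfaceι (fermatPolynomial ℂ n (k * m))) x).rep i ^ k)
    {a : Fin (n + 2) → ℂˣ} (ha : a ∈ fermatGroup n (k * m)) :
    (AlgPoints.mapContinuous (L := ℂ) π).comp
        (diagonalMap (fermatPolynomial ℂ n (k * m)) (fermatGroup_le_diagonalStabilizer (k * m) ha)) =
      (diagonalMap (fermatPolynomial ℂ n m)
          (fermatGroup_le_diagonalStabilizer m (pow_mem_fermatGroup_of_mem_mul ha))).comp
        (AlgPoints.mapContinuous (L := ℂ) π) := by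
  refine ContinuousMap.coe_injective (funext fun x ↦ ?_)
  apply (isEmbedding_hypersurfacePoint (SmoothHypersurface.hypersurfaceι (fermatPolynomial ℂ n m))).injective
  rw [ContinuousMap.comp_apply, ContinuousMap.comp_apply, AlgPoints.mapContinuous_apply,
    AlgPoints.mapContinuous_apply, hypersurfacePoint_diagonalMap,
    ← Projectivization.mk_rep (hypersurfacePoint _ (AlgPoints.map π (diagonalMap _ _ x))),
    Projectivization.mk_eq_mk_iff']
  -- the three coordinate descriptions
  obtain ⟨t₁, ht₁⟩ := hπ (diagonalMap _ (fermatGroup_le_diagonalStabilizer (k * m) ha) x)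
  obtain ⟨s, hs⟩ := exists_rep_hypersurfacePoint_diagonalMap (fermatPolynomial ℂ n (k * m))
    (fermatGroup_le_diagonalStabilizer (k * m) ha) x
  obtain ⟨t₂, ht₂⟩ := hπ x
  have ht₂0 : t₂ ≠ 0 := by
    intro h0
    refine Projectivization.rep_nonzero
      (hypersurfacePoint (SmoothHypersurface.hypersurfaceι (fermatPolynomial ℂ n m)) (AlgPoints.map π x)) ?_
    rw [ht₂, h0, zero_smul]
  refine ⟨t₁ * s ^ k * t₂⁻¹, ?_⟩
  rw [ht₁, ht₂, hs]
  funext i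
  simp only [Pi.smul_apply, smul_eq_mul, smul_apply_eq_mul, Pi.pow_apply, Units.val_pow_eq_pow_val,
    mul_pow]
  field_simp

/-- **`g_a^* (π^* y) = π^* (g_{aᵏ}^* y)`** on `H^d(–(ℂ); ℂ)`: the cohomological form of
`π ∘ g_a = g_{aᵏ} ∘ π` (contravariance of `singularCohomology.map`).
[cite: ShiodaKatsura1979, §1] [cite: daSilva2021HodgeFermat, Thm. 2.8] -/
theorem map_diagonalMap_map_of_levelMap
    (π : fermatHypersurface n (k * m) ⟶ fermatHypersurface n m)
    (hπ : ∀ x, ∃ t : ℂ, (hypersurfacePoint (SmoothHypersurface.hypersurfaceι (fermatPolynomial ℂ n m))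
        (AlgPoints.map π x)).rep =
      t • fun i => (hypersurfacePoint (SmoothHypersurface.hypersurfaceι (fermatPolynomial ℂ n (k * m))) x).rep i ^ k)
    {a : Fin (n + 2) → ℂˣ} (ha : a ∈ fermatGroup n (k * m)) (d : ℕ)
    (y : complexBetti (fermatHypersurface n m) d) :
    singularCohomology.map ℂ ℂ
        (diagonalMap (fermatPolynomial ℂ n (k * m)) (fermatGroup_le_diagonalStabilizer (k * m) ha)) d
        (complexBetti.map π d y) =
      complexBetti.map π d (singularCohomology.map ℂ ℂ (diagonalMap (fermatPolynomial ℂ n m)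
        (fermatGroup_le_diagonalStabilizer m (pow_mem_fermatGroup_of_mem_mul ha))) d y) := by
  change (complexBetti.map π d ≫ singularCohomology.map ℂ ℂ
      (diagonalMap (fermatPolynomial ℂ n (k * m)) (fermatGroup_le_diagonalStabilizer (k * m) ha)) d) y =
    (singularCohomology.map ℂ ℂ (diagonalMap (fermatPolynomial ℂ n m)
      (fermatGroup_le_diagonalStabilizer m (pow_mem_fermatGroup_of_mem_mul ha))) d ≫
        complexBetti.map π d) y
  rw [complexBetti.map, ← singularCohomology.map_comp, ← singularCohomology.map_comp,
    mapContinuous_comp_diagonalMap_of_levelMap π hπ ha]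

/-- **`π^* V_m(γ) ⊆ V_{km}(k • γ)`**: the pull-back along the level map of the `γ`-eigenspace of
`μₘⁿ⁺²` lies in the `(k • γ)`-eigenspace of `μ_{km}ⁿ⁺²` —
`g_a^*(π^* c) = π^*(g_{aᵏ}^* c) = χ_γ(aᵏ) π^* c = χ_{k•γ}(a) π^* c`. This is the input (M2) of the
sibling `stub_claimLevelPush_of_levelMap`, derived from the points formula.
[cite: ShiodaKatsura1979, §1] [cite: Aoki1987, §1 p. 387] -/
theorem map_mem_fermatEigenspace_of_levelMap [NeZero m] (hk : 0 < k)
    (π : fermatHypersurface n (k * m) ⟶ fermatHypersurface n m)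
    (hπ : ∀ x, ∃ t : ℂ, (hypersurfacePoint (SmoothHypersurface.hypersurfaceι (fermatPolynomial ℂ n m))
        (AlgPoints.map π x)).rep =
      t • fun i => (hypersurfacePoint (SmoothHypersurface.hypersurfaceι (fermatPolynomial ℂ n (k * m))) x).rep i ^ k)
    {γ : Fin (n + 2) → ZMod m} {d : ℕ} {c : complexBetti (fermatHypersurface n m) d}
    (hc : c ∈ fermatEigenspace m γ d) :
    complexBetti.map π d c ∈ fermatEigenspace (k * m) (fun i ↦ ((k * (γ i).val : ℕ) : ZMod (k * m))) d := by
  rw [mem_fermatEigenspace_iff] at hc ⊢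
  intro a
  rw [map_diagonalMap_map_of_levelMap π hπ a.2 d c, hc ⟨_, pow_mem_fermatGroup_of_mem_mul a.2⟩,
    map_smul, fermatCharacter_levelRaise hk γ a.2]

end Equivariance

/-! ### S2↑ `stub_claimLevelPull` from the level map -/

section LevelPull

/-- **S2↑ `stub_claimLevelPull` from the level map (conditional form, registered).** GRANTED, for all
`m, k ≥ 1` and `r`, a morphism `π : X²ʳ_{km} ⟶ X²ʳₘ` of the standard models with (M2) the points
formula of `[xᵢ] ↦ [xᵢᵏ]` (homogeneous coordinates of `π(x)` are a scalar multiple of `(zᵢᵏ)ᵢ`),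
(M3) `π.left` flat, and (M4) transfer (every class of `H²ʳ(X²ʳ_{km}(ℂ); ℂ)` fixed by
`K = {a ∈ μ_{km}^{2r+2} | aᵏ = 1}` is in the range of `π^*`), claim pulls back along the level map:
claim_m(α') ⟹ claim_{km}(k • α') for every `k ≥ 1` and zero-free `α'` — the registered statement of
`stub_claimLevelPull`. Proof: for `c ∈ V_{km}(k • α')` and `a ∈ K`, `g_a^* c = χ_{k•α'}(a) c = c`
(`fermatCharacter_levelRaise_eq_one`), so `c = π^* c₀` (M4); `c₀ = Σ_γ proj_γ c₀`
(`sum_fermatProjector`) with `π^* proj_γ c₀ ∈ V_{km}(k • γ)` (`map_mem_fermatEigenspace_of_levelMap`),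
and applying the projector onto `V_{km}(k • α')` (`γ ↦ k • γ` injective, `levelRaise_injective`)
leaves `c = π^*(proj_{α'} c₀)`; `proj_{α'} c₀ ∈ V_m(α') ⊆ Nʳ H²ʳ(X_m)` by claim_m(α'), and flat
pull-back preserves `Nʳ H²ʳ` (`map_mem_algebraicClasses_of_flat`). Degenerate cases `r = 0`
(`FermatCharacter.claim_zero`), `m = 0` (`claim_level_zero`). REMAINING CONSTRUCTIONS (not in the
tree, 2026-08-17): (M1) the morphism `π`, (M3), (M4).
[cite: ShiodaKatsura1979, §1] [cite: Aoki1987, §1 p. 387 and Cor. 2-3 (p. 388)]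
[cite: daSilva2021HodgeFermat, Thm. 2.8] [cite: Hartshorne1977, III Prop. 9.5] -/
theorem stub_claimLevelPull_of_levelMap :
    (∀ (m k r : ℕ), 0 < m → 0 < k → ∃ π : fermatHypersurface (2 * r) (k * m) ⟶ fermatHypersurface (2 * r) m,
      (∀ x, ∃ t : ℂ, (hypersurfacePoint (SmoothHypersurface.hypersurfaceι (fermatPolynomial ℂ (2 * r) m)) (AlgPoints.map π x)).rep =
          t • fun i => (hypersurfacePoint (SmoothHypersurface.hypersurfaceι (fermatPolynomial ℂ (2 * r) (k * m))) x).rep i ^ k) ∧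
      Flat π.left ∧
      (∀ c : complexBetti (fermatHypersurface (2 * r) (k * m)) (2 * r),
        (∀ (a : Fin (2 * r + 2) → ℂˣ) (ha : a ∈ fermatGroup (2 * r) (k * m)), a ^ k = 1 →
          singularCohomology.map ℂ ℂ (diagonalMap (fermatPolynomial ℂ (2 * r) (k * m)) (fermatGroup_le_diagonalStabilizer (k * m) ha)) (2 * r) c = c) →
        c ∈ LinearMap.range (complexBetti.map π (2 * r)).hom)) →
    ∀ (m k r : ℕ) (α' : Fin (2 * r + 2) → ZMod m), 0 < k → (∀ i, α' i ≠ 0) →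
      FermatCharacter.Claim m r α' →
        FermatCharacter.Claim (k * m) r (fun i => ((k * (α' i).val : ℕ) : ZMod (k * m))) := by
  intro hM m k r α' hk _hα' hC
  rcases Nat.eq_zero_or_pos r with rfl | hr
  · exact FermatCharacter.claim_zero (k * m) _
  rcases Nat.eq_zero_or_pos m with rfl | hm
  · exact claim_level_zero r _
  haveI : NeZero m := ⟨hm.ne'⟩
  have hkm : 0 < k * m := Nat.mul_pos hk hm
  haveI : NeZero (k * m) := ⟨hkm.ne'⟩
  obtain ⟨π, h2, h3, h4⟩ := hM m k r hm hk
  haveI : Flat π.left := h3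
  haveI : IsLocallyNoetherian (fermatHypersurface (2 * r) (k * m)).left :=
    IsSmoothProjective.isLocallyNoetherian_holds (isSmoothProjective_fermatHypersurface (by omega) hkm)
  haveI : IsLocallyNoetherian (fermatHypersurface (2 * r) m).left :=
    IsSmoothProjective.isLocallyNoetherian_holds (isSmoothProjective_fermatHypersurface (by omega) hm)
  intro c hc
  -- Step 1: `c` is `K`-invariant, hence `c = π^* c₀`
  obtain ⟨c₀, hc₀⟩ : c ∈ LinearMap.range (complexBetti.map π (2 * r)).hom := by
    refine h4 c fun a ha hak ↦ ?_
    rw [(mem_fermatEigenspace_iff.mp hc) ⟨a, ha⟩, fermatCharacter_levelRaise_eq_one hk α' ha hak,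
      Units.val_one, one_smul]
  -- Step 2/3: `c = π^* (proj_{α'} c₀)`
  have hsum : c = ∑ γ : Fin (2 * r + 2) → ZMod m, complexBetti.map π (2 * r) (fermatProjector m γ (2 * r) c₀) := by
    rw [← map_sum, sum_fermatProjector]
    exact hc₀.symm
  have key : c = complexBetti.map π (2 * r) (fermatProjector m α' (2 * r) c₀) := by
    rw [← fermatProjector_apply_of_mem hc]
    conv_lhs => rw [hsum, map_sum]
    rw [Finset.sum_eq_single α']
    · exact fermatProjector_apply_of_mem
        (map_mem_fermatEigenspace_of_levelMap hk π h2 (fermatProjector_mem α' c₀))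
    · intro γ _ hγ
      exact fermatProjector_apply_of_mem_of_ne
        (map_mem_fermatEigenspace_of_levelMap hk π h2 (fermatProjector_mem γ c₀))
        fun h ↦ hγ (levelRaise_injective hk h)
    · exact fun h ↦ absurd (Finset.mem_univ α') h
  -- Step 4: flat pull-back of an algebraic class
  rw [key]
  exact map_mem_algebraicClasses_of_flat π (hC (fermatProjector_mem α' c₀))

end LevelPull

end Summit.HodgeConjecture.HodgeConjecture.Theorems.CancelByAnyClaimLattice

end
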